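import Summits.QuantumFields.YangMills.Theorems.FluctuationComparisonRegPrIntLS2BetaKeyLemmaRecord
import Summits.QuantumFields.YangMills.Theorems.FluctuationComparisonRegPrIntLS2BetaOneLevelStep
import HarnessLib

/-!
# S2β · `hFlat` road, UV3-NODE §57.8 (C) ∕ §64.2 ∕ §65.3 — F1 END-TO-END: THE KEY LEMMA ON THE T³ RECORD, BY KERNEL
# (`hF1` of ✓p817191 `…HFlatOfFeeders.relLetter_of_feeders` with `Kc := exp 1` and NO displayed hypothesis: F1-DOCK ∘ the (C)-STEP)

Cell `ym3-torus` (YM ladder rung R3 = continuum `SU(2)` Yang–Mills on the three-torus — a RUNG: NOT d = 4, NOT infinite volume, NOT a mass gap,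
NOT Clay).  Width seat «width 13» `ym3-torus-px13` (gen 23), FREE px helper on crux `stmt-QuantumFields-20520`
(`Theses.UnitScaleTilt.FluctuationComparisonRegPrIntL`); `--kind proof --supports stmt-QuantumFields-20520 --as helper`, count-neutral, DEFINITION-FREE
(0 `def`, 0 `instance`, 0 `notation`, 0 `sorry`, default heartbeats); sixty lines of plumbing over two landed files.

WHAT.  ✓px13 g23 `…KeyLemmaRecord.keyLemma_record_uniform` (F1-DOCK: the guarded tower of ✓px8 g21 G11 + ✓px12 g23's tent kernel (R)(C)(N) + ✓px10 g22's
neighbourhood Schur bound + ✓`thresholdSum_small`) reduces the KEY LEMMA on the record to ONE per-level step inequality, offered WITH the premises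
`PlaqSmall θBal(K−t) (M^tU)` and `θBal(K−t) ≤ a₀`; ✓px10 g22 `…OneLevelStep.oneLevelStep_nbhd` (the (C)-STEP: one (0.4) averaging with the printed
`exp[mean log]` on `SU(N)`, through ✓px8 g21's G9∕G10∕G14 letters and ✓p817168∕✓p817170) IS that inequality with `C₁ = 14((d+2)L)²`, `C₂ = 4096((d+2)L)⁴` under
the guards `((d+2)L)²θ ≤ 1∕50`, `((d+2)L)²∕4·θ < δ_2` — both consequences of `θ ≤ a₀ := min (1∕(50((d+2)L)²)) (2δ_2∕((d+2)L)²)`.  Composing: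
* ★★★★ `keyLemma_record` — `∀ L > 1, ∀ b₀ p₀ > 0, ∃ γ₁ > 0, ∀ γ ∈ (0, γ₁], ∀ F (F.L = L), ∀ J ≤ K, ∀ U ∈ histGood F ℰp (θBal F.L γ b₀ p₀) K J, ∀ t ≤ K − J,`
  `√(Σ_p dist1((M^tU)(∂p))²) ≤ exp 1 · √(F.L)^t · √(Σ_p dist1(U(∂p))²)` — the `ℓ²` plaquette flux of the `t`-fold (0.4) average of a good history grows at
  most like `(√L)^t` with a DEPTH-FREE constant: §57.8 (C)'s KEY LEMMA `‖f^{(t)}‖₂ ≤ K·L^{t∕2}·‖f‖₂` on the nose, `K = e`.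

USE.  The (H)-assembler (✓p817191 `relLetter_of_feeders`, then ✓p816498 `hFlat_of_letter`) takes `hF1 := keyLemma_record …` (KERNEL DOCK of the shape:
HOME `ym3-torus-px13/g23/DOCK-F1-vs-px17hF1.cert.px13g23.lean`); `Kc = exp 1` enters `HL`'s `C := Kc·(√(2Cs)(1 + C_F√L) + √CL·C_c)` — chosen before `(b₀, p₀)` as
`HL` requires — and `γ₁(L, b₀, p₀)` joins the minimum over the feeders' coupling thresholds.

HONEST SCOPE.  Two guard inequalities and an instantiation; the one-level analysis is ✓`…OneLevelStep` over the Banach-algebra letters G4∕G6∕G10∕G14 and lit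
(26)–(27) — an elementary substitute AT THE FLAT DATUM for [Balaban1985RegularSpaces] Lemma 1 ∕ [Balaban1984PropagatorsII] §1, NOT Bałaban's propagator analysis,
none of which is asserted or proved here; (H), `hFlat`, TUBE-REG∘, GAP♯∘ (`stub_uniformFibreGapOrbit`), EXW∘, DET-REP-B, S2β, crux 20520, 19936, 19200 and
`YM3TorusSU2` are NOT proved; no registered stub is closed; rung R3 = SU(2) YM₃ on T³ at fixed lattice data — NOT d = 4, NOT infinite volume, NOT a mass gap,
NOT Clay; the Yang–Mills mass gap is NOT proved.  References: T. Bałaban, CMP **99** (1985) 75–102 [Balaban1985RegularSpaces] (Lemma 1 p.79); CMP **98**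
(1985) 17–51 [Balaban1985Averaging] ((19) p.21); CMP **102** (1985) 255–275 [Balaban1985UV3] ((3), (7) pp.256–257).
-/

set_option autoImplicit false

noncomputable section

namespace Summit.QuantumFields.YangMills.Theorems.FluctuationComparisonRegPrIntLS2BetaKeyLemmaRecordE2E

open Finset
open Literature.MathematicalPhysics.QuantumFieldTheory.Balaban1983to89
open T4Continuum T3ContinuumYM3Torus T3UnitScaleTilt BlockAveraging
open T4CubeChartGnomonic (SU2)
open T3UnitLawDensityEML (ℰp)
open ExpMeanLog (expMeanLogSU deltaSU deltaSU_pos)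
open Summit.QuantumFields.YangMills.Theorems.FluctuationComparisonRegPrIntLS2BetaKeyLemmaRecord (keyLemma_record_uniform)
open Summit.QuantumFields.YangMills.Theorems.FluctuationComparisonRegPrIntLS2BetaOneLevelStep (oneLevelStep_nbhd)

/-- ★★★★ **F1 — THE KEY LEMMA ON THE T³ RECORD, BY KERNEL** (UV3-NODE §57.8 (C) ∕ §64.2; the `hF1` binder of ✓p817191 `relLetter_of_feeders` with
`Kc := exp 1`, NO displayed hypothesis left): for every block size `L > 1` and profile `b₀, p₀ > 0` there is `γ₁ > 0` such that for `0 < γ ≤ γ₁`, every T³ family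
with `F.L = L`, every `J ≤ K`, every GOOD HISTORY `U ∈ histGood K J` (all `(0.4)` averages `M^tU`, `t ≤ K − J`, `θBal(K−t)`-small) and every `t ≤ K − J`:
`√(Σ_p dist1((M^tU)(∂p))²) ≤ exp 1 · √(F.L)^t · √(Σ_p dist1(U(∂p))²)` — the `ℓ²` flux of the `t`-fold average grows at most like `(√L)^t`, DEPTH-FREE constant.
Proof: ✓`keyLemma_record_uniform` (guarded tower + threshold sum) ∘ px10 g22's (C)-STEP ✓`oneLevelStep_nbhd` at every level (`C₁ = 14((d+2)L)²`,
`C₂ = 4096((d+2)L)⁴`, guard `a₀ = min (1∕(50((d+2)L)²)) (2δ_2∕((d+2)L)²)`). [cite: Balaban1985RegularSpaces, Lemma 1 p.79; Balaban1985Averaging, (19) p.21; Balaban1985UV3, (7) p.257] -/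
theorem keyLemma_record (L : ℕ) (hL : 1 < L) (b₀ p₀ : ℝ) (hb : 0 < b₀) (hp : 0 < p₀) :
    ∃ γ₁ : ℝ, 0 < γ₁ ∧ ∀ γ : ℝ, 0 < γ → γ ≤ γ₁ →
      ∀ (F : T3Family), F.L = L → ∀ (J K : ℕ), J ≤ K → ∀ U : GaugeField (F.P K) 0 SU2,
        U ∈ histGood F ℰp (θBal F.L γ b₀ p₀) K J →
        ∀ t, t ≤ K - J →
          √(∑ p, dist1 (GaugeField.plaqHol (Averaging.iter (fun k => blockAvg (P := F.P K) (j := k) ℰp) t U) p) ^ 2) ≤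
            Real.exp 1 * Real.sqrt (F.L : ℝ) ^ t * √(∑ p, dist1 (GaugeField.plaqHol U p) ^ 2) := by
  -- the (C)-STEP constants and the guard, functions of `L` only
  set X : ℝ := (((3 + 2) * L : ℕ) : ℝ) with hX
  have hX0 : 0 < X := by rw [hX]; exact_mod_cast (by omega : 0 < (3 + 2) * L)
  have hX2 : 0 < X ^ 2 := by positivity
  have hδ2 : 0 < deltaSU (Fin 2) := deltaSU_pos
  set a₀ : ℝ := min (1 / (50 * X ^ 2)) (2 * deltaSU (Fin 2) / X ^ 2) with ha₀
  have ha₀pos : 0 < a₀ := lt_min (by positivity) (by positivity)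
  obtain ⟨γ₁, hγ₁, H⟩ := keyLemma_record_uniform L hL (C₁ := 14 * X ^ 2) (C₂ := 4096 * X ^ 4) (a₀ := a₀)
    (by positivity) (by positivity) ha₀pos b₀ p₀ hb hp
  refine ⟨γ₁, hγ₁, fun γ hγ hγle F hFL J K hJK U hU => ?_⟩
  obtain ⟨Hθ, HF⟩ := H γ hγ hγle
  refine HF F hFL J K hJK U hU fun t ht hsm ha Q => ?_
  -- the (C)-STEP at level `t`: guards from `θBal(K−t) ≤ a₀`
  subst hFL
  have hlev : t + 1 ≤ (F.P K).m + (F.P K).K := by show t + 1 ≤ F.m + K; omega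
  have hθ0 : 0 ≤ θBal F.L γ b₀ p₀ (K - t) := (Hθ _).1
  have hXF : (((F.P K).d + 2) * (F.P K).L : ℕ) = (3 + 2) * F.L := rfl
  have h1 : θBal F.L γ b₀ p₀ (K - t) ≤ 1 / (50 * X ^ 2) := ha.trans (min_le_left _ _)
  have h2 : θBal F.L γ b₀ p₀ (K - t) ≤ 2 * deltaSU (Fin 2) / X ^ 2 := ha.trans (min_le_right _ _)
  have hθ : ((((F.P K).d + 2) * (F.P K).L : ℕ) : ℝ) ^ 2 * θBal F.L γ b₀ p₀ (K - t) ≤ 1 / 50 := by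
    rw [hXF]
    calc X ^ 2 * θBal F.L γ b₀ p₀ (K - t) ≤ X ^ 2 * (1 / (50 * X ^ 2)) := mul_le_mul_of_nonneg_left h1 hX2.le
      _ = 1 / 50 := by field_simp
  have hδ : ((((F.P K).d + 2) * (F.P K).L : ℕ) : ℝ) ^ 2 / 4 * θBal F.L γ b₀ p₀ (K - t) < deltaSU (Fin 2) := by
    rw [hXF]
    calc X ^ 2 / 4 * θBal F.L γ b₀ p₀ (K - t) ≤ X ^ 2 / 4 * (2 * deltaSU (Fin 2) / X ^ 2) :=
          mul_le_mul_of_nonneg_left h2 (by positivity)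
      _ = deltaSU (Fin 2) / 2 := by field_simp; ring
      _ < deltaSU (Fin 2) := by linarith
  have h3 := oneLevelStep_nbhd (n := Fin 2) hlev (Averaging.iter (fun k => blockAvg (P := F.P K) (j := k) ℰp) t U) hθ0 hθ hδ hsm Q
  rw [hXF] at h3
  exact h3

end Summit.QuantumFields.YangMills.Theorems.FluctuationComparisonRegPrIntLS2BetaKeyLemmaRecordE2E

end
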